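import Summits.QuantumFields.YangMills.Theorems.FlatTubeReductionOffTubeSuppressionPrelim
import Summits.QuantumFields.YangMills.Theorems.FemtoTransferGapSlabFlowLift
import Summits.QuantumFields.YangMills.Theorems.FemtoTransferGapZeroModes
import Summits.QuantumFields.YangMills.Theorems.FemtoTransferGapRungW1upAlgebra
import HarnessLib

/-!
# Cut-and-reorthogonalise: the Hilbert-space step `PinnedReorthogonalise` of crux K1b `ValleyRelocalisation`
# (route `FlatTubeReduction`, item stmt-QuantumFields-25191; stub S3 of the planner's BC3 skeleton `ValleyRelocalisation_birth.lean`; rung R2b1)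

Seat `ym-line-sfw-p1` g9 (prover; planner-of-record ym-idea-1).  The elementary half of the valley relocalisation: if a physical tube state
`ψ ⊥ Ω` has at most a fraction `δ` of its `L²`-mass on the UNPINNED region `OUT` (some Polyakov holonomy `β^{−1/3+κ}`-far from the centre),
and the positive ground state `Ω` keeps at least half of its mass on the pinned tube `PT = {S ≤ β^{−θ}} ∖ OUT`, then cutting `ψ` to `PT` and
re-orthogonalising against `Ω` with `1_{PT}Ω` costs at most `8√δ·λ₀‖ψ‖²` in the transfer form and does not increase the norm.

* §1 ★ `reorthogonalised_cut` — the GENERIC statement for any region `R` whose indicator cut-offs of `Ω`, `ψ` are physical: with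
  `‖Ω‖² ≤ 2‖1_RΩ‖²`, `‖1_{Rᶜ}ψ‖² ≤ δ‖ψ‖²` (`0 ≤ δ ≤ 1`), the state `ψ' = 1_Rψ − a·1_RΩ` is physical, `⊥ Ω`, supported in `R`, `‖ψ'‖² ≤ ‖ψ‖²`
  and `⟨ψ,K_βψ⟩ ≤ ⟨ψ',K_βψ'⟩ + 8√δ·λ₀·‖ψ‖²` (Cauchy–Schwarz for the positive form, `⟨f,K_βf⟩ ≤ λ₀‖f‖²`; `ψ − ψ' = 1_{Rᶜ}ψ + a·1_RΩ` has
  `‖·‖² ≤ 3δ‖ψ‖²`);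
* §2 the pinned region is measurable, gauge invariant (Polyakov holonomies are conjugated, `polyakovSite_gaugeTransform`, `scalarPart_conj`) and
  twist invariant (`polyakovSite_twist`: a central twist multiplies one holonomy by `±1`, `scalarPart_negOne_mul`, and the region only sees
  `|Re tr|`);
* §3 ★★ `pinnedReorthogonalise` — VERBATIM the stub `PinnedReorthogonalise` of the planner's skeleton (evidence `ValleyRelocalisation_birth.lean`
  on stmt-QuantumFields-25191): K1b ⇐ `MaximiserValleyTail` ∧ `GroundPinnedMass` ∧ THIS.

HONEST FRAMING: Hilbert-space bookkeeping; the Agmon/Airy tail of maximisers (S1) and the ground-state pinning (S2) are OPEN.  R2b1 is a RECORD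
rung: nothing here concerns infinite volume, the continuum, or the Clay Yang–Mills mass gap.  No definitions, no named facts, no `sorry`.
-/

set_option autoImplicit false

noncomputable section

open MeasureTheory Filter Topology Real
open Literature.MathematicalPhysics.QuantumFieldTheory
open Literature.MathematicalPhysics.QuantumLattice

namespace Summit.QuantumFields.YangMills.Theorems.FemtoTransferGap

namespace TubeMax

open Summit.QuantumFields.YangMills.Theorems.FemtoTransferGap.OffTube

variable {L : ℕ} [NeZero L]

/-! ## §1 The generic re-orthogonalised cut -/

/-- `⟨1_R f, 1_{Rᶜ} g⟩ = 0` (disjoint supports). [folklore] -/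
theorem l2_indicator_compl_zero (R : Set (GaugeConfig 3 L SU2)) (f g : GaugeConfig 3 L SU2 → ℝ) :
    l2 (R.indicator f) (Rᶜ.indicator g) = 0 := by
  have h : ∀ U, R.indicator f U * Rᶜ.indicator g U = 0 := fun U => by
    by_cases hU : U ∈ R
    · rw [Set.indicator_of_notMem (fun h : U ∈ Rᶜ => (Set.mem_compl_iff R U).1 h hU), mul_zero]
    · rw [Set.indicator_of_notMem hU, zero_mul]
  unfold l2
  simp only [h, integral_zero]

/-- ★ **The re-orthogonalised cut, generic region.**  `β ≥ 0`; `Ω` physical, `ψ` with physical indicator cut-offs along `R`/`Rᶜ`; `ψ ⊥ Ω`;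
`‖Ω‖² ≤ 2‖1_RΩ‖²`, `0 < ‖1_RΩ‖²`; `‖1_{Rᶜ}ψ‖² ≤ δ‖ψ‖²` with `0 ≤ δ ≤ 1`.  Then `ψ' = 1_Rψ − a·1_RΩ` (`a = ⟨1_Rψ,Ω⟩/‖1_RΩ‖²`) is physical,
`⊥ Ω`, vanishes off `R`, `‖ψ'‖² ≤ ‖ψ‖²`, and `⟨ψ,K_βψ⟩ ≤ ⟨ψ',K_βψ'⟩ + 8√δ·λ₀·‖ψ‖²`. [cite: ReedSimonIV1978, Thm. XIII.1] -/
theorem reorthogonalised_cut {β : ℝ} (hβ : 0 ≤ β) {R : Set (GaugeConfig 3 L SU2)} {Ω ψ : GaugeConfig 3 L SU2 → ℝ}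
    (hΩ : IsPhys Ω) (hRΩ : IsPhys (R.indicator Ω)) (hRcΩ : IsPhys (Rᶜ.indicator Ω))
    (hRψ : IsPhys (R.indicator ψ)) (hRcψ : IsPhys (Rᶜ.indicator ψ)) (horth : l2 ψ Ω = 0) {δ : ℝ} (hδ0 : 0 ≤ δ) (hδ1 : δ ≤ 1)
    (hmassΩ : l2 Ω Ω ≤ 2 * l2 (R.indicator Ω) (R.indicator Ω)) (hposΩ : 0 < l2 (R.indicator Ω) (R.indicator Ω))
    (hmassψ : l2 (Rᶜ.indicator ψ) (Rᶜ.indicator ψ) ≤ δ * l2 ψ ψ) :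
    ∃ ψ' : GaugeConfig 3 L SU2 → ℝ, IsPhys ψ' ∧ l2 ψ' Ω = 0 ∧ (∀ U, U ∉ R → ψ' U = 0) ∧ l2 ψ' ψ' ≤ l2 ψ ψ ∧
      qform su2Rep β ψ ψ ≤ qform su2Rep β ψ' ψ' + 8 * Real.sqrt δ * topValue su2Rep L β * l2 ψ ψ := by
  have hlam0 : 0 < topValue su2Rep L β := topValue_su2Rep_pos L β
  have hP0 : 0 ≤ l2 ψ ψ := l2_self_nonneg ψ
  have hSu0 : 0 ≤ l2 (Rᶜ.indicator ψ) (Rᶜ.indicator ψ) := l2_self_nonneg _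
  have hSw0 : 0 ≤ l2 (Rᶜ.indicator Ω) (Rᶜ.indicator Ω) := l2_self_nonneg _
  have hScP : l2 (R.indicator ψ) (R.indicator ψ) ≤ l2 ψ ψ := l2_indicator_self_le hRψ hRcψ
  have hSwN : l2 (Rᶜ.indicator Ω) (Rᶜ.indicator Ω) ≤ l2 Ω Ω := l2_indicator_compl_self_le hRΩ hRcΩ
  -- the coefficient
  set a : ℝ := l2 (R.indicator ψ) Ω / l2 (R.indicator Ω) (R.indicator Ω) with ha
  have haSv : a * l2 (R.indicator Ω) (R.indicator Ω) = l2 (R.indicator ψ) Ω := div_mul_cancel₀ _ hposΩ.ne'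
  have hsum : l2 (R.indicator ψ) Ω + l2 (Rᶜ.indicator ψ) (Rᶜ.indicator Ω) = 0 := by
    have h := horth
    rw [← Set.indicator_self_add_compl R ψ, l2_add_left hRψ hRcψ hΩ, l2_indicator_left Rᶜ ψ Ω] at h
    exact h
  have hCSa : l2 (Rᶜ.indicator ψ) (Rᶜ.indicator Ω) ^ 2 ≤ l2 (Rᶜ.indicator ψ) (Rᶜ.indicator ψ) * l2 (Rᶜ.indicator Ω) (Rᶜ.indicator Ω) :=
    sq_l2_le hRcψ hRcΩ
  have hcv : l2 (R.indicator ψ) (R.indicator Ω) = a * l2 (R.indicator Ω) (R.indicator Ω) := by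
    rw [haSv, ← l2_indicator_left R ψ Ω]
  -- the witness
  have hψ' : IsPhys (R.indicator ψ + (-a) • R.indicator Ω) := hRψ.add (hRΩ.smul (-a))
  have horth' : l2 (R.indicator ψ + (-a) • R.indicator Ω) Ω = 0 := by
    rw [l2_add_left hRψ (hRΩ.smul (-a)) hΩ, l2_smul_left, l2_indicator_left R Ω Ω, ← haSv]
    ring
  have hnorm_eq : l2 (R.indicator ψ + (-a) • R.indicator Ω) (R.indicator ψ + (-a) • R.indicator Ω) =
      l2 (R.indicator ψ) (R.indicator ψ) - a ^ 2 * l2 (R.indicator Ω) (R.indicator Ω) := by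
    rw [l2_add_add hRψ (hRΩ.smul (-a)), l2_comm (R.indicator ψ) ((-a) • R.indicator Ω), l2_smul_left,
      l2_comm (R.indicator Ω) (R.indicator ψ), hcv, l2_smul_left, l2_comm (R.indicator Ω) ((-a) • R.indicator Ω), l2_smul_left]
    ring
  have hnorm : l2 (R.indicator ψ + (-a) • R.indicator Ω) (R.indicator ψ + (-a) • R.indicator Ω) ≤ l2 ψ ψ := by
    rw [hnorm_eq]
    have : 0 ≤ a ^ 2 * l2 (R.indicator Ω) (R.indicator Ω) := mul_nonneg (sq_nonneg a) hposΩ.le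
    linarith [hScP]
  have hS'0 : 0 ≤ l2 (R.indicator ψ + (-a) • R.indicator Ω) (R.indicator ψ + (-a) • R.indicator Ω) := l2_self_nonneg _
  refine ⟨R.indicator ψ + (-a) • R.indicator Ω, hψ', horth', fun U hU => ?_, hnorm, ?_⟩
  · simp only [Pi.add_apply, Pi.smul_apply, smul_eq_mul, Set.indicator_of_notMem hU, mul_zero, add_zero]
  -- the remainder `r = a·1_RΩ + 1_{Rᶜ}ψ` and the expansion
  have hr : IsPhys (a • R.indicator Ω + Rᶜ.indicator ψ) := (hRΩ.smul a).add hRcψ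
  have hdec : ψ = (R.indicator ψ + (-a) • R.indicator Ω) + (a • R.indicator Ω + Rᶜ.indicator ψ) := by
    funext U
    have h := congrFun (Set.indicator_self_add_compl R ψ) U
    simp only [Pi.add_apply] at h
    simp only [Pi.add_apply, Pi.smul_apply, smul_eq_mul]
    linarith
  have hexp : qform su2Rep β ψ ψ =
      qform su2Rep β (R.indicator ψ + (-a) • R.indicator Ω) (R.indicator ψ + (-a) • R.indicator Ω) +
        2 * qform su2Rep β (R.indicator ψ + (-a) • R.indicator Ω) (a • R.indicator Ω + Rᶜ.indicator ψ) +
        qform su2Rep β (a • R.indicator Ω + Rᶜ.indicator ψ) (a • R.indicator Ω + Rᶜ.indicator ψ) := by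
    have h0 : qform su2Rep β ψ ψ =
        qform su2Rep β ((R.indicator ψ + (-a) • R.indicator Ω) + (a • R.indicator Ω + Rᶜ.indicator ψ))
          ((R.indicator ψ + (-a) • R.indicator Ω) + (a • R.indicator Ω + Rᶜ.indicator ψ)) := by
      rw [← hdec]
    rw [h0, qform_add_add β hψ' hr]
  -- `‖r‖² = a²‖1_RΩ‖² + ‖1_{Rᶜ}ψ‖² ≤ 3δ‖ψ‖²`
  have hr_norm : l2 (a • R.indicator Ω + Rᶜ.indicator ψ) (a • R.indicator Ω + Rᶜ.indicator ψ) =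
      a ^ 2 * l2 (R.indicator Ω) (R.indicator Ω) + l2 (Rᶜ.indicator ψ) (Rᶜ.indicator ψ) := by
    rw [l2_add_add (hRΩ.smul a) hRcψ, l2_smul_left, l2_comm (R.indicator Ω) (a • R.indicator Ω), l2_smul_left, l2_smul_left,
      l2_indicator_compl_zero R Ω ψ]
    ring
  have haSv' : a ^ 2 * l2 (R.indicator Ω) (R.indicator Ω) ≤ 2 * l2 (Rᶜ.indicator ψ) (Rᶜ.indicator ψ) := by
    -- `a‖v‖² = −⟨u,w⟩`, `⟨u,w⟩² ≤ ‖u‖²‖w‖² ≤ ‖u‖²·2‖v‖²`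
    have haX : a * l2 (R.indicator Ω) (R.indicator Ω) = -l2 (Rᶜ.indicator ψ) (Rᶜ.indicator Ω) := by linarith [haSv, hsum]
    have h1 : (a * l2 (R.indicator Ω) (R.indicator Ω)) ^ 2 ≤
        l2 (Rᶜ.indicator ψ) (Rᶜ.indicator ψ) * (2 * l2 (R.indicator Ω) (R.indicator Ω)) := by
      rw [haX, neg_sq]
      exact hCSa.trans (mul_le_mul_of_nonneg_left (hSwN.trans hmassΩ) hSu0)
    have h2 : a ^ 2 * l2 (R.indicator Ω) (R.indicator Ω) * l2 (R.indicator Ω) (R.indicator Ω) ≤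
        2 * l2 (Rᶜ.indicator ψ) (Rᶜ.indicator ψ) * l2 (R.indicator Ω) (R.indicator Ω) := by
      calc a ^ 2 * l2 (R.indicator Ω) (R.indicator Ω) * l2 (R.indicator Ω) (R.indicator Ω)
          = (a * l2 (R.indicator Ω) (R.indicator Ω)) ^ 2 := by ring
        _ ≤ l2 (Rᶜ.indicator ψ) (Rᶜ.indicator ψ) * (2 * l2 (R.indicator Ω) (R.indicator Ω)) := h1
        _ = 2 * l2 (Rᶜ.indicator ψ) (Rᶜ.indicator ψ) * l2 (R.indicator Ω) (R.indicator Ω) := by ring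
    exact le_of_mul_le_mul_right h2 hposΩ
  have hr_le : l2 (a • R.indicator Ω + Rᶜ.indicator ψ) (a • R.indicator Ω + Rᶜ.indicator ψ) ≤ 3 * δ * l2 ψ ψ := by
    rw [hr_norm]
    linarith [haSv', hmassψ]
  -- transfer-form bounds
  have hQr : qform su2Rep β (a • R.indicator Ω + Rᶜ.indicator ψ) (a • R.indicator Ω + Rᶜ.indicator ψ) ≤
      topValue su2Rep L β * (3 * δ * l2 ψ ψ) :=
    (qform_le_topValue_mul_l2 hβ hr).trans (mul_le_mul_of_nonneg_left hr_le hlam0.le)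
  have hQ' : qform su2Rep β (R.indicator ψ + (-a) • R.indicator Ω) (R.indicator ψ + (-a) • R.indicator Ω) ≤
      topValue su2Rep L β * l2 ψ ψ :=
    (qform_le_topValue_mul_l2 hβ hψ').trans (mul_le_mul_of_nonneg_left hnorm hlam0.le)
  have hQr0 : 0 ≤ qform su2Rep β (a • R.indicator Ω + Rᶜ.indicator ψ) (a • R.indicator Ω + Rᶜ.indicator ψ) :=
    qform_su2Rep_self_nonneg hβ hr
  have hcross : qform su2Rep β (R.indicator ψ + (-a) • R.indicator Ω) (a • R.indicator Ω + Rᶜ.indicator ψ) ^ 2 ≤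
      (topValue su2Rep L β * l2 ψ ψ) * (topValue su2Rep L β * (3 * δ * l2 ψ ψ)) :=
    (sq_qform_le hβ hψ' hr).trans (mul_le_mul hQ' hQr hQr0 (mul_nonneg hlam0.le hP0))
  -- `√δ` bookkeeping: `δ ≤ √δ`, `3δ ≤ 4(√δ)²`
  have hs0 : 0 ≤ Real.sqrt δ := Real.sqrt_nonneg δ
  have hs2 : Real.sqrt δ ^ 2 = δ := Real.sq_sqrt hδ0
  have hs1 : Real.sqrt δ ≤ 1 := Real.sqrt_le_one.mpr hδ1
  have hδs : δ ≤ Real.sqrt δ := by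
    calc δ = Real.sqrt δ * Real.sqrt δ := by rw [← sq, hs2]
      _ ≤ Real.sqrt δ * 1 := mul_le_mul_of_nonneg_left hs1 hs0
      _ = Real.sqrt δ := mul_one _
  have hGP0 : 0 ≤ 2 * Real.sqrt δ * (topValue su2Rep L β * l2 ψ ψ) := by positivity
  have hc3 : |qform su2Rep β (R.indicator ψ + (-a) • R.indicator Ω) (a • R.indicator Ω + Rᶜ.indicator ψ)| ≤
      2 * Real.sqrt δ * (topValue su2Rep L β * l2 ψ ψ) := by
    refine abs_le_of_sq_le_sq ?_ hGP0
    calc qform su2Rep β (R.indicator ψ + (-a) • R.indicator Ω) (a • R.indicator Ω + Rᶜ.indicator ψ) ^ 2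
        ≤ (topValue su2Rep L β * l2 ψ ψ) * (topValue su2Rep L β * (3 * δ * l2 ψ ψ)) := hcross
      _ = 3 * δ * (topValue su2Rep L β * l2 ψ ψ) ^ 2 := by ring
      _ ≤ 4 * Real.sqrt δ ^ 2 * (topValue su2Rep L β * l2 ψ ψ) ^ 2 := by
          rw [hs2]
          exact mul_le_mul_of_nonneg_right (by linarith) (sq_nonneg _)
      _ = (2 * Real.sqrt δ * (topValue su2Rep L β * l2 ψ ψ)) ^ 2 := by ring
  have e1 : qform su2Rep β (R.indicator ψ + (-a) • R.indicator Ω) (a • R.indicator Ω + Rᶜ.indicator ψ) ≤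
      2 * Real.sqrt δ * (topValue su2Rep L β * l2 ψ ψ) := (le_abs_self _).trans hc3
  have e2 : qform su2Rep β (a • R.indicator Ω + Rᶜ.indicator ψ) (a • R.indicator Ω + Rᶜ.indicator ψ) ≤
      3 * Real.sqrt δ * (topValue su2Rep L β * l2 ψ ψ) := by
    calc qform su2Rep β (a • R.indicator Ω + Rᶜ.indicator ψ) (a • R.indicator Ω + Rᶜ.indicator ψ)
        ≤ topValue su2Rep L β * (3 * δ * l2 ψ ψ) := hQr
      _ = 3 * δ * (topValue su2Rep L β * l2 ψ ψ) := by ring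
      _ ≤ 3 * Real.sqrt δ * (topValue su2Rep L β * l2 ψ ψ) :=
          mul_le_mul_of_nonneg_right (by linarith) (mul_nonneg hlam0.le hP0)
  have e3 : 0 ≤ Real.sqrt δ * (topValue su2Rep L β * l2 ψ ψ) := by positivity
  rw [hexp]
  linarith [e1, e2, e3]

/-! ## §2 The pinned region is measurable and invariant -/

/-- The trace entering the pinning condition is twice the scalar part. [folklore] -/
theorem re_trace_su2Rep (g : SU2) : ((su2Rep g).trace).re = 2 * scalarPart g := by
  simp only [fundamentalRep_apply, re_trace_eq_two_mul_scalarPart]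

/-- The unpinned region `OUT = {∃ x e, c < 2 − |Re tr P_e(x)|}` is measurable. [folklore] -/
theorem measurableSet_unpinned (c : ℝ) :
    MeasurableSet {U : GaugeConfig 3 L SU2 | ∃ (x : Site 3 L) (e : Edge 3 1), c < 2 - |((su2Rep (polyakovSite x U e)).trace).re|} := by
  have h : {U : GaugeConfig 3 L SU2 | ∃ (x : Site 3 L) (e : Edge 3 1), c < 2 - |((su2Rep (polyakovSite x U e)).trace).re|} =
      ⋃ x : Site 3 L, ⋃ e : Edge 3 1, {U : GaugeConfig 3 L SU2 | c < 2 - |((su2Rep (polyakovSite x U e)).trace).re|} := by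
    ext U; simp only [Set.mem_setOf_eq, Set.mem_iUnion]
  rw [h]
  refine MeasurableSet.iUnion fun x => MeasurableSet.iUnion fun e => ?_
  have hc : Continuous fun U : GaugeConfig 3 L SU2 => 2 - |((su2Rep (polyakovSite x U e)).trace).re| := by
    simp only [re_trace_su2Rep]
    exact continuous_const.sub ((continuous_const.mul
      (continuous_scalarPart.comp ((continuous_apply e).comp (continuous_polyakovSite x)))).abs)
  exact measurableSet_lt measurable_const hc.measurable

/-- The unpinned region is gauge invariant (the Polyakov holonomies are conjugated). [folklore] -/
theorem mem_unpinned_gaugeTransform (c : ℝ) (g : Site 3 L → SU2) (U : GaugeConfig 3 L SU2) :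
    gaugeTransform g U ∈ {U : GaugeConfig 3 L SU2 | ∃ (x : Site 3 L) (e : Edge 3 1), c < 2 - |((su2Rep (polyakovSite x U e)).trace).re|} ↔
      U ∈ {U : GaugeConfig 3 L SU2 | ∃ (x : Site 3 L) (e : Edge 3 1), c < 2 - |((su2Rep (polyakovSite x U e)).trace).re|} := by
  simp only [Set.mem_setOf_eq, re_trace_su2Rep, polyakovSite_gaugeTransform, gaugeTransform_one_site_eq, scalarPart_conj]

/-- The unpinned region is invariant under central twists (`z = ±1` multiplies one holonomy; `|Re tr|` is unchanged). [cite: tHooft1979] -/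
theorem mem_unpinned_twist (c : ℝ) (k : Fin 3) {z : SU2} (hz : z ∈ Subgroup.center SU2) (U : GaugeConfig 3 L SU2) :
    twist k z U ∈ {U : GaugeConfig 3 L SU2 | ∃ (x : Site 3 L) (e : Edge 3 1), c < 2 - |((su2Rep (polyakovSite x U e)).trace).re|} ↔
      U ∈ {U : GaugeConfig 3 L SU2 | ∃ (x : Site 3 L) (e : Edge 3 1), c < 2 - |((su2Rep (polyakovSite x U e)).trace).re|} := by
  simp only [Set.mem_setOf_eq, re_trace_su2Rep, polyakovSite_twist k hz, twist_one_site]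
  rcases eq_one_or_eq_negOne_of_mem_center hz with rfl | rfl
  · simp
  · refine exists_congr fun x => exists_congr fun e => ?_
    by_cases he : e.2 = k
    · rw [if_pos he, scalarPart_negOne_mul, abs_mul, abs_neg, ← abs_mul]
    · rw [if_neg he]

/-- The pinned tube `PT = {¬(β^{−θ} < S)} ∩ {¬ OUT}` is measurable. [folklore] -/
theorem measurableSet_pinnedTube (η c : ℝ) :
    MeasurableSet {U : GaugeConfig 3 L SU2 | ¬ (η < wilsonAction su2Rep U) ∧
      ¬ (∃ (x : Site 3 L) (e : Edge 3 1), c < 2 - |((su2Rep (polyakovSite x U e)).trace).re|)} := by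
  have h : {U : GaugeConfig 3 L SU2 | ¬ (η < wilsonAction su2Rep U) ∧
      ¬ (∃ (x : Site 3 L) (e : Edge 3 1), c < 2 - |((su2Rep (polyakovSite x U e)).trace).re|)} =
      {U : GaugeConfig 3 L SU2 | wilsonAction su2Rep U ≤ η} ∩
        {U : GaugeConfig 3 L SU2 | ∃ (x : Site 3 L) (e : Edge 3 1), c < 2 - |((su2Rep (polyakovSite x U e)).trace).re|}ᶜ := by
    ext U; simp only [Set.mem_setOf_eq, Set.mem_inter_iff, Set.mem_compl_iff, not_lt]
  rw [h]
  exact (measurableSet_tube η).inter (measurableSet_unpinned c).compl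

/-- The pinned tube is gauge invariant. [folklore] -/
theorem mem_pinnedTube_gaugeTransform (η c : ℝ) (g : Site 3 L → SU2) (U : GaugeConfig 3 L SU2) :
    gaugeTransform g U ∈ {U : GaugeConfig 3 L SU2 | ¬ (η < wilsonAction su2Rep U) ∧
      ¬ (∃ (x : Site 3 L) (e : Edge 3 1), c < 2 - |((su2Rep (polyakovSite x U e)).trace).re|)} ↔
    U ∈ {U : GaugeConfig 3 L SU2 | ¬ (η < wilsonAction su2Rep U) ∧
      ¬ (∃ (x : Site 3 L) (e : Edge 3 1), c < 2 - |((su2Rep (polyakovSite x U e)).trace).re|)} := by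
  have h := mem_unpinned_gaugeTransform (L := L) c g U
  simp only [Set.mem_setOf_eq] at h ⊢
  rw [wilsonAction_gaugeTransform, h]

/-- The pinned tube is twist invariant. [cite: tHooft1979] -/
theorem mem_pinnedTube_twist (η c : ℝ) (k : Fin 3) {z : SU2} (hz : z ∈ Subgroup.center SU2) (U : GaugeConfig 3 L SU2) :
    twist k z U ∈ {U : GaugeConfig 3 L SU2 | ¬ (η < wilsonAction su2Rep U) ∧
      ¬ (∃ (x : Site 3 L) (e : Edge 3 1), c < 2 - |((su2Rep (polyakovSite x U e)).trace).re|)} ↔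
    U ∈ {U : GaugeConfig 3 L SU2 | ¬ (η < wilsonAction su2Rep U) ∧
      ¬ (∃ (x : Site 3 L) (e : Edge 3 1), c < 2 - |((su2Rep (polyakovSite x U e)).trace).re|)} := by
  have h := mem_unpinned_twist (L := L) c k hz U
  simp only [Set.mem_setOf_eq] at h ⊢
  rw [wilsonAction_twist_of_mem_center su2Rep k hz U, h]

/-- Indicator cut-offs along the pinned tube are physical. [folklore] -/
theorem isPhys_indicator_pinnedTube (η c : ℝ) {ψ : GaugeConfig 3 L SU2 → ℝ} (hψ : IsPhys ψ) :
    IsPhys ({U : GaugeConfig 3 L SU2 | ¬ (η < wilsonAction su2Rep U) ∧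
      ¬ (∃ (x : Site 3 L) (e : Edge 3 1), c < 2 - |((su2Rep (polyakovSite x U e)).trace).re|)}.indicator ψ) :=
  isPhys_indicator (measurableSet_pinnedTube η c) (mem_pinnedTube_gaugeTransform η c) (fun k _ hz U => mem_pinnedTube_twist η c k hz U) hψ

/-- Complementary cut-offs along the pinned tube are physical. [folklore] -/
theorem isPhys_indicator_pinnedTube_compl (η c : ℝ) {ψ : GaugeConfig 3 L SU2 → ℝ} (hψ : IsPhys ψ) :
    IsPhys ({U : GaugeConfig 3 L SU2 | ¬ (η < wilsonAction su2Rep U) ∧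
      ¬ (∃ (x : Site 3 L) (e : Edge 3 1), c < 2 - |((su2Rep (polyakovSite x U e)).trace).re|)}ᶜ.indicator ψ) :=
  isPhys_indicator_compl (measurableSet_pinnedTube η c) (mem_pinnedTube_gaugeTransform η c)
    (fun k _ hz U => mem_pinnedTube_twist η c k hz U) hψ

/-! ## §3 The stub `PinnedReorthogonalise` of the K1b skeleton -/

/-- ★★ **`PinnedReorthogonalise`** — VERBATIM stub S3 of the planner's BC3 skeleton of crux K1b `ValleyRelocalisation`
(stmt-QuantumFields-25191; `ValleyRelocalisation ⇐ MaximiserValleyTail ∧ GroundPinnedMass ∧ PinnedReorthogonalise`): cut a tube state `ψ ⊥ Ω`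
with off-pinning mass `≤ δ‖ψ‖²` to the pinned tube, re-orthogonalise against `Ω` (which keeps half its mass there), pay `8√δ·λ₀‖ψ‖²`.
(`κ`, `θ` only name the regions; `0 < β` and `Ω > 0` enter only through `0 < ‖Ω‖²`.) [cite: ReedSimonIV1978, Thm. XIII.1] -/
theorem pinnedReorthogonalise :
    ∀ (L : ℕ) [NeZero L] (θ κ β δ : ℝ), 0 < β → 0 ≤ δ → δ ≤ 1 → ∀ (Ω ψ : Literature.MathematicalPhysics.QuantumFieldTheory.GaugeConfig 3 L SU2 → ℝ), IsPhys Ω → (∀ U, 0 < Ω U) → l2 Ω Ω ≤ 2 * l2 (Set.indicator {U : Literature.MathematicalPhysics.QuantumFieldTheory.GaugeConfig 3 L SU2 | ¬ (β ^ (-θ) < Literature.MathematicalPhysics.QuantumFieldTheory.wilsonAction su2Rep U) ∧ ¬ (∃ (x : Literature.MathematicalPhysics.QuantumFieldTheory.Site 3 L) (e : Literature.MathematicalPhysics.QuantumFieldTheory.Edge 3 1), β ^ (-(2 : ℝ) / 3 + 2 * κ) < 2 - |((su2Rep (polyakovSite x U e)).trace).re|)} Ω) (Set.indicator {U : Literature.MathematicalPhysics.QuantumFieldTheory.GaugeConfig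 3 L SU2 | ¬ (β ^ (-θ) < Literature.MathematicalPhysics.QuantumFieldTheory.wilsonAction su2Rep U) ∧ ¬ (∃ (x : Literature.MathematicalPhysics.QuantumFieldTheory.Site 3 L) (e : Literature.MathematicalPhysics.QuantumFieldTheory.Edge 3 1), β ^ (-(2 : ℝ) / 3 + 2 * κ) < 2 - |((su2Rep (polyakovSite x U e)).trace).re|)} Ω) → IsPhys ψ → l2 ψ Ω = 0 → (∀ U, β ^ (-θ) < Literature.MathematicalPhysics.QuantumFieldTheory.wilsonAction su2Rep U → ψ U = 0) → l2 (Set.indicator {U : Literature.MathematicalPhysics.QuantumFieldTheory.GaugeConfig 3 L SU2 | ∃ (x : Literature.MathematicalPhysics.QuantumFieldTheory.Site 3 L) (e : Literature.MathematicalPhysics.QuantumFieldTheory.Edge 3 1), β ^ (-(2 : ℝ) / 3 + 2 * κ) < 2 - |((su2Rep (polyakovSite x U e)).trace).re|} ψ) (Set.indicator {U : Literature.MathematicalPhysics.QuantumFieldTheory.GaugeConfig 3 L SU2 | ∃ (x : Literature.MathematicalPhysics.QuantumFieldTheory.Site 3 L) (e : Literature.MathematicalPhysics.QuantumFieldTheory.Edge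 3 1), β ^ (-(2 : ℝ) / 3 + 2 * κ) < 2 - |((su2Rep (polyakovSite x U e)).trace).re|} ψ) ≤ δ * l2 ψ ψ → ∃ ψ' : Literature.MathematicalPhysics.QuantumFieldTheory.GaugeConfig 3 L SU2 → ℝ, IsPhys ψ' ∧ l2 ψ' Ω = 0 ∧ (∀ U, β ^ (-θ) < Literature.MathematicalPhysics.QuantumFieldTheory.wilsonAction su2Rep U → ψ' U = 0) ∧ (∀ U, (∃ (x : Literature.MathematicalPhysics.QuantumFieldTheory.Site 3 L) (e : Literature.MathematicalPhysics.QuantumFieldTheory.Edge 3 1), β ^ (-(2 : ℝ) / 3 + 2 * κ) < 2 - |((su2Rep (polyakovSite x U e)).trace).re|) → ψ' U = 0) ∧ l2 ψ' ψ' ≤ l2 ψ ψ ∧ qform su2Rep β ψ ψ ≤ qform su2Rep β ψ' ψ' + 8 * Real.sqrt δ * topValue su2Rep L β * l2 ψ ψ := by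
  intro L _ θ κ β δ hβ hδ0 hδ1 Ω ψ hΩ hΩpos hmassΩ hψ horth hsupp hmassψ
  -- the pinned tube `PT` and its indicator cut-offs
  set PT : Set (GaugeConfig 3 L SU2) := {U : GaugeConfig 3 L SU2 | ¬ (β ^ (-θ) < wilsonAction su2Rep U) ∧
      ¬ (∃ (x : Site 3 L) (e : Edge 3 1), β ^ (-(2 : ℝ) / 3 + 2 * κ) < 2 - |((su2Rep (polyakovSite x U e)).trace).re|)} with hPT
  have hRΩ : IsPhys (PT.indicator Ω) := isPhys_indicator_pinnedTube _ _ hΩ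
  have hRcΩ : IsPhys (PTᶜ.indicator Ω) := isPhys_indicator_pinnedTube_compl _ _ hΩ
  have hRψ : IsPhys (PT.indicator ψ) := isPhys_indicator_pinnedTube _ _ hψ
  have hRcψ : IsPhys (PTᶜ.indicator ψ) := isPhys_indicator_pinnedTube_compl _ _ hψ
  -- `‖Ω‖² > 0` (Ω > 0 everywhere), hence `‖1_{PT}Ω‖² > 0`
  have hN0 : 0 < l2 Ω Ω := by
    have hint : Integrable (fun U => Ω U * Ω U) (configMeasure SU2 L) := hΩ.integrable_mul hΩ
    unfold l2
    rw [integral_pos_iff_support_of_nonneg_ae (ae_of_all _ fun U => mul_self_nonneg (Ω U)) hint]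
    have hs : Function.support (fun U => Ω U * Ω U) = Set.univ :=
      Set.eq_univ_of_forall fun U => Function.mem_support.2 (mul_pos (hΩpos U) (hΩpos U)).ne'
    rw [hs, measure_univ]
    exact one_pos
  have hposΩ : 0 < l2 (PT.indicator Ω) (PT.indicator Ω) := by linarith
  -- off the pinned tube, a tube-supported `ψ` lives on `OUT`: `1_{PTᶜ}ψ = 1_{OUT}ψ`
  have hmassψ' : l2 (PTᶜ.indicator ψ) (PTᶜ.indicator ψ) ≤ δ * l2 ψ ψ := by
    have hfun : PTᶜ.indicator ψ = {U : GaugeConfig 3 L SU2 | ∃ (x : Site 3 L) (e : Edge 3 1),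
        β ^ (-(2 : ℝ) / 3 + 2 * κ) < 2 - |((su2Rep (polyakovSite x U e)).trace).re|}.indicator ψ := by
      funext U
      by_cases hS : β ^ (-θ) < wilsonAction su2Rep U
      · -- outside the action tube `ψ` vanishes, so both sides are `0`
        have h0 : ψ U = 0 := hsupp U hS
        simp only [Set.indicator_apply, h0, ite_self]
      · by_cases hO : ∃ (x : Site 3 L) (e : Edge 3 1), β ^ (-(2 : ℝ) / 3 + 2 * κ) < 2 - |((su2Rep (polyakovSite x U e)).trace).re|
        · have hU : U ∈ PTᶜ := by
            rw [Set.mem_compl_iff, hPT, Set.mem_setOf_eq, not_and_or, not_not, not_not]; exact Or.inr hO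
          rw [Set.indicator_of_mem hU, Set.indicator_of_mem (by exact hO)]
        · have hU : U ∉ PTᶜ := by
            rw [Set.mem_compl_iff, not_not, hPT, Set.mem_setOf_eq]; exact ⟨hS, hO⟩
          rw [Set.indicator_of_notMem hU, Set.indicator_of_notMem (by exact hO)]
    rw [hfun]
    exact hmassψ
  obtain ⟨ψ', hψ', horth', hsupp', hnorm', hq'⟩ :=
    reorthogonalised_cut hβ.le hΩ hRΩ hRcΩ hRψ hRcψ horth hδ0 hδ1 hmassΩ hposΩ hmassψ'
  refine ⟨ψ', hψ', horth', fun U hU => hsupp' U ?_, fun U hU => hsupp' U ?_, hnorm', hq'⟩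
  · rw [hPT, Set.mem_setOf_eq, not_and_or, not_not]; exact Or.inl hU
  · rw [hPT, Set.mem_setOf_eq, not_and_or, not_not, not_not]; exact Or.inr hU

end TubeMax

end Summit.QuantumFields.YangMills.Theorems.FemtoTransferGap

end
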